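import Mathlib
import HarnessLib
import HarnessLib.Audit
import Summits.Langlands.Statement
import HarnessLib.Audit.Check
import Literature.NumberTheory.GaloisRepresentations.ArtinLFunction
import Literature.NumberTheory.GaloisRepresentations.ArtinConductor
import Literature.NumberTheory.Automorphic.GLnAdelicStructureProofs
import Literature.NumberTheory.Automorphic.LocalLanglandsGLProofs
import Literature.NumberTheory.Automorphic.LocalConstantsProofs
import HarnessLib.Audit.Status.Attr

/-!
Route: HybridParityDefect

# Route HybridParityDefect — certified automorphy defect of the Galois-predicted hybrid weight-one ⊗
Maass series for a mixed-parity icosahedral Artin representation over ℚ(√5) can refute typed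
reciprocity

NEGATION / operator D (computational witness), refutation shape (closes : C1 → C2 → C3 → ¬Langlands;
the frame item Assembly = (C1 ∧ C2 ∧ C3) → ¬Langlands, i.e. X → ¬Langlands for the thesis
conjunction X, is proved inside closes). Let F = ℚ(√5) with real
embeddings ι₁, ι₂ and σ : Γ_F → GL₂(ℂ) an irreducible Artin representation with INSOLUBLE
(icosahedral) image of MIXED PARITY: odd at ι₁
(signature (1,1)) and even-scalar at ι₂ (σ(c₂) = ±I). Typed conjunct (B) at n = 2 over F, applied to
an ℓ-adic avatar of σ^∨, yields a
cuspidal π with `Corresponds` at EVERY finite place; comparing the functional equation of L(s,π)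
with Brauer's for the Artin L(s,σ) pins π_∞
to (weight-one limit of discrete series at ι₁, Maass eigenvalue 1/4 at ι₂) WITHOUT any Hodge–Tate
recipe, and newform theory forces the
K₁(𝔣(σ))-newvector on ℍ × ℍ to be the EXPLICIT hybrid series f_σ(z₁,z₂) = Σ_{ξ ∈ 𝔡⁻¹, ι₁ξ>0}
a_σ((ξ√5)) ε(ξ) e(ι₁ξ z₁) √y₂ K₀(2π|ι₂ξ|y₂)
e(ι₂ξ x₂) (a_σ = Artin Dirichlet coefficients, tree `ArtinRep.eulerFactorAt`; ε the Maass sign). X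
(the bet, C1) = for some such σ of
conductor norm ≤ 10¹⁰ the series f_σ is NOT weight-(1,0) automorphic under Γ₁(𝔣(σ)) ∩ SL₂(𝓞): a
nonzero automorphy defect at one point —
decided, for any given (σ, γ, z), by one ball-arithmetic evaluation of two truncations with rigorous
tails. X ∧ C2 ∧ C3 → ¬Langlands. No idea
card is realised (none exists in the mixed-parity sector).
Lean: `HybridDefectWitness ∧ HybridDictionary ∧ ArtinAvatarSupply`

## Assembly
Pure logic, refutation shape, crux-leaning (gate crux-only rule 2026-08-16): the deciding theorem is
`closes : HybridDefectWitness → HybridDictionary → ArtinAvatarSupply → ¬Langlands` — binders = the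
two cruxes C1, C2 and the open SUPPORT
C3 (a glue obligation known in substance, to be landed by a prover and then used by name) — and the
frame item is
`Assembly := (HybridDefectWitness ∧ HybridDictionary ∧ ArtinAvatarSupply) → ¬Langlands`, i.e. frame
#1 `X → ¬Langlands` for the thesis
conjunction X of the `Lean:` line (rev 10; the gate neither drops nor asides an assembly item, so it
stays declared and provable-now — a
prover may land it verbatim as `theorem … : Assembly` from the block below). `Assembly` is PROVED
inside `closes`
(`have cert : Assembly := by rintro ⟨h₁', h₂', h₃'⟩ hL; …`, sorry-free, axioms
propext/Classical.choice/Quot.sound) and applied to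
⟨h₁, h₂, h₃⟩, so it lies in the cone of the deciding theorem as a derived item, never an assumed
hypothesis (audit cone at rev 10:
binder_used = C1, C2, C3; in_cone 4/4; unused []). The argument: assume `Langlands`; from
HybridDefectWitness obtain the field data
(F, a, ι₁, ι₂), the representation σ and the failure of hybrid automorphy; `Langlands F` gives
`Nonempty (ReciprocityData F)`, take 𝓡, and
conjunct (B) at n = 2 (hcpt := `isCompact_glFiniteIntegralLevel_holds 2 F`); ArtinAvatarSupply gives
ℓ, ι, ρ (avatar of σ^∨) irreducible
and geometric; (B) gives a cuspidal L-algebraic π with `Corresponds 𝓡 ι π ρ`; HybridDictionary turns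
it into hybrid automorphy of f_σ —
contradiction. All three mathematical hypotheses are load-bearing (each BC2 probe C → ¬Langlands
fails); `Assembly` alone does not give
¬Langlands either (it needs the two cruxes and the supply item).

Rationale: WHY THIS LINE. All three existing negation routes (QuarterDeficit1951, DedekindDeficit1951,
DedekindQuotient1951) decide an EVEN icosahedral instance over ℚ by
heavy analytic censuses (certified Selberg trace formula, ≈10³ core-days; certified ζ_K zero
ledgers); every other computational idea on
this summit has been graded a variant of those (bottom-eigenvalue-census, serre-count-census) or
declined for proving no conjunct. The new
instrument here is that reciprocity SUPPLIES THE CANDIDATE: for an Artin σ the predicted automorphic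
form is an explicit, absolutely convergent
Whittaker series whose every coefficient and both archimedean Whittaker functions are known in
closed form (weight one and Maass parameter 0
both have "motivic weight zero", so no normalisation shifts), and its automorphy under ONE generic
element of Γ₁(𝔣) at ONE point is a
two-sided certified inequality costing core-hours, not core-years (Booker's 2005 non-rigorous
modularity tests for GL₂/ℚ, zbl:1122.11032, and
Booker–Strömbergsson–Venkatesh's certification of Maass forms on SL₂(ℤ),
doi:10.1155/IMRN/2006/71281, are the GL₂/ℚ ancestors; Selberg's
hybrid forms and Kelmer's hybrid trace formula arXiv:1208.5955 define the objects; nobody has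
computed a hybrid Artin form). The sector is the
one the structural methods provably cannot see: holomorphic/coherent and p-adic methods need total
oddness (Pilloni–Stroh, Sasaki; the card
hodge-parity-lock-hybrid-vacuity was declined precisely because "no engine" exists here),
trace-formula censuses would need a hybrid trace
formula in ball arithmetic that has never been implemented, while Langlands–Tunnell shows hybrid
Artin newforms DO exist for solvable images
(dihedral Ind ψ with ψ of mixed signature are explicit hybrid theta series — the route's
calibration). Imported: classical Hilbert–Maass
newform theory (Casselman 1973, Shimura 1978, Jacquet–Langlands), Artin L-functions with Brauer's
functional equation (Martinet 1977; tree
`ArtinLFunctionContinuationFE`), rigorous special-function numerics (Arb, arXiv:1611.02831),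
explicit Galois theory of A₅ / 2.A₅ fields
(Crespo 1989 doi:10.1016/0021-8693(89)90263-6; Dokchitser–Dokchitser arXiv:1009.5388). The
HT-blindness of the typed summit (no
archimedean clause in `Corresponds`) — which wrecks census-type refutations over fields without
Galois representations for the competitors —
is neutralised by the Γ-factor pole-set lemma: two completed L-functions with the same finite part
and both functional equations have the
same Γ-factor, so π_∞ is pinned by theorems (automorphic FE + Artin FE), not by conjectures.

RANKED CRUXES. #2 HybridDefectWitness (crux) — [computational bet] over the golden field F = ℚ(√5)
(typed: finrank 2, a² = 5, embeddings ι₁ ≠ ι₂) there is σ : Γ_F → GL₂(ℂ) irreducible with finite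
insoluble image, signature (1,1) at ι₁ and (2,0) or (0,2) at ι₂, Artin conductor norm ≤ 10¹⁰, such
that the explicit hybrid series f_σ (Artin Dirichlet coefficients of the ideals (ξ√5), ξ ∈ 𝔡⁻¹ with
ι₁ξ > 0; Maass sign ε₂ on ι₂ξ < 0; e(ι₁ξ z₁)·√y₂K₀(2π|ι₂ξ|y₂)·e(ι₂ξ x₂)) violates weight-(1,0)
automorphy f(γz) = (ι₁(γ)z₁+ι₁(δ)) f(z) for some (α β; γ δ) ∈ SL₂(𝓞) with γ ∈ 𝔣(σ), α ≡ δ ≡ 1 mod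
𝔣(σ), at some point of ℍ × ℍ. Pipeline for ONE kit job chain: box-search quintics over ℤ[ω] with
square discriminant, A₅ group over F and real-root counts (5 | 1) at (ι₂ | ι₁) (half-real
icosahedral field, not base change); Crespo lift to 2.A₅ and minimal-conductor twist; Frobenius
classes in 2.A₅ (Dokchitsers' algorithm) ⇒ a_σ(𝔭), ramified Euler factors ⇒ all a_σ(𝔪); Arb
evaluation of the two truncations at heights ~N(𝔣)^(-1/2) with the explicit tail bound;
TRUE-certificate (defect ≥ η > tails) ⇒ with C2, C3: ¬Langlands; FALSE-certificate (defect ≤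
10⁻²⁰·|f| at ≥ 10 generic (γ,z) for the smallest examples) ⇒ route closes
refuted:HybridDefectWitness with the certificate = first evidence for a hybrid icosahedral
strong-Artin instance. CALIBRATION first: the same pipeline on σ = Ind ψ (ψ a mixed-signature
ray-class character of a totally real quadratic K/F), whose hybrid theta series IS automorphic
(Hecke–Maass), must return defect 0 — this validates every convention of C2 before betting.
[difficulty: L] (why it might fail: Langlands is true: (B) over ℚ(√5) gives the hybrid newform, so
f_σ is exactly automorphic and every certified defect is ≤ tail; also no mixed-parity icosahedral σ
of conductor norm ≤ 10¹⁰ might exist (then C1 is false vacuously).) [zbl:1122.11032,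
doi:10.1155/IMRN/2006/71281, arXiv:1208.5955, doi:10.1016/0021-8693(89)90263-6, arXiv:1009.5388,
arXiv:1611.02831, DoudMoore2006]
#3 HybridDictionary (crux) — [typed reciprocity ⇒ the explicit series is the newform] for F, a, ι₁,
ι₂ golden data, σ mixed-parity icosahedral, ρ an ℓ-adic framed representation with ι(ᵗρ⁻¹) = σ
(avatar of σ^∨ — the Frobenius bookkeeping of `Corresponds`: arithmetic Frobenius of ρ has
eigenvalues α_j⁻¹, the newform coefficient is Σα_j, the tree's Artin Euler factors use arithmetic
Frobenius), every cuspidal L-algebraic π of GL₂(𝔸_F) with `Corresponds 𝓡 ι π ρ` makes f_σ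
weight-(1,0) automorphic under Γ₁(𝔣(σ)) ∩ SL₂(𝓞). Chain: LGC at all finite v ⇒ conductor(π) = 𝔣(σ),
L_v(s,π) = L_v(s,σ) (rec preserves L- and ε-factors), central character det σ^∨; automorphic FE of
Λ(s,π) (JL) and Artin FE of Λ(s,σ) (Brauer) with equal finite parts ⇒ γ_π/γ_σ =
c·(γ_π/γ_σ)(1−s)⁻¹-type identity ⇒ equal pole multisets ⇒ π_ι₁ = PS(1,sgn) (weight-one limit DS),
π_ι₂ = PS(sgnᵃ,sgnᵃ) with (−1)ᵃ = σ(c₂) — no Hodge–Tate input; Casselman newvector is K₁(𝔣)-fixed;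
class number and narrow class number one ⇒ one classical component; Fourier expansion over 𝔡⁻¹ =
(1/√5)𝓞 with the weight-one (e^{2πiξ₁z₁}, ξ₁ > 0) and weight-zero parameter-0 (√y K₀, sign ε₂ under
ξ ↦ ωξ from diag(ω,1) ∈ K₀) Whittaker functions; coefficients = Hecke eigenvalues = Dirichlet
coefficients of L(s,π) = a_σ(𝔪) for ALL 𝔪 (ramified 𝔭 through rec_𝔭, composite by multiplicativity),
normalised a_σ(𝓞) = 1. [difficulty: L] (why it might fail: as TYPED: `IsLocalLanglandsGL` may not
expose L- /ε-factor preservation strongly enough to read ramified coefficients and 𝔣(σ) off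
`Corresponds`; a convention slip (sign rule, 𝔡⁻¹, automorphy factor, dual) would falsify the
identity — the dihedral calibration catches it.) [Casselman1973, BuzzardGeeLMS2014,
HarrisTaylorAMS2001, TateCorvallis1979, MartinetDurham1977, doi:10.1215/S0012-7094-78-04529-5,
arXiv:1208.5955]
#4 ArtinAvatarSupply (support since rev 2 — a glue obligation of `closes`, known in substance and
templated in-tree by FramedRep.isOpen_ker_of_finite_range,
fontainePstAdicCompletion_isDeRhamFramed_of_finite_range and the PROVED ℚ-analogue
QuarterDeficit1951.IcosahedralSupply) — [supply] every mixed-parity icosahedral σ : Γ_F → GL₂(ℂ)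
has, for every reciprocity datum 𝓡 of F, some prime ℓ, some field isomorphism ι : ℚ̄_ℓ ≃ ℂ and a
framed ℓ-adic ρ with ι(ᵗρ⁻¹) = σ (avatar of the contragredient) that is irreducible and geometric in
the summit's sense (`IsGeometricFramed 𝓡 ρ`: a.e. unramified; de Rham at v ∣ ℓ for the PINNED
Fontaine datum — choose ℓ above which σ is unramified, the case the structure axioms of
`PstWeilDeligneData` cover, exactly as in the landed QuarterDeficit1951IcosahedralSupplyAway).
Witness: ρ := ι⁻¹ ∘ σ^∨, continuous because the kernel is open (finite image), irreducible because σ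
is. [difficulty: M] (why it might fail: as TYPED: continuity of ι⁻¹∘σ^∨ into GL₂(ℚ̄_ℓ) and
`IsDeRhamFramed` for the pinned datum must be derivable from finite image + unramified-at-ℓ with the
tree's current `PstWeilDeligneData` interface; if the interface is weaker than for the 1951 supply,
the item stalls (not false).) [BuzzardGeeLMS2014, FontaineMazurGeometric1995, DeligneSerreASENS1974,
DoudMoore2006]

TWO-LAYER PLAN. If a compute seat takes C1: HybridDefectWitness ⇐ TailConvergence (absolute
convergence / explicit tail bound of the hybrid series on
{Im ≥ y₀}) → DefectCertificate (the finite ball-arithmetic inequality with margin η for all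
truncations T ≥ T₀) — glued and kernel-checked in
bc/HybridDefectWitness_birth.lean (limit + `ge_of_tendsto`). HybridDictionary ⇐
NewformHybridExpansion (Corresponds ⇒ an admissible
coefficient function b with Satake link and sign rule whose generic hybrid series is
Γ₁(𝔣)-automorphic: archimedean pinning + newvector +
Fourier expansion) → CoefficientsAreArtin (multiplicity one + LGC at every finite place ⇒ b = the
Artin coefficients) — glued in
bc/HybridDictionary_birth.lean. ArtinAvatarSupply ⇐ DualAvatarExists → GeometricAway — glued in
bc/ArtinAvatarSupply_birth.lean. Depth 1 each.

KILL CRITERIA. FALSE-certificate for C1 (calibration passes AND the smallest mixed-parity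
icosahedral examples show certified defects ≤ 10⁻²⁰·|f_σ| at ≥ 10
generic (γ, z)) ⇒ close `refuted:HybridDefectWitness` with the certificate files as evidence (first
numerical evidence for a hybrid
icosahedral strong-Artin instance; hand C2/C3 to any future positive mixed-parity route).
Calibration FAILS (dihedral hybrid theta series shows a
defect) ⇒ C2 is misstated (convention): repair C2/C1 together (`--restate`), never claim ¬Langlands
from an uncalibrated pipeline. A proof of
strong Artin for mixed-parity icosahedral σ over real quadratic fields (e.g. via
EvenArtinGL4Door-type doors run for genuinely-over-F σ) moots
the bet and closes the route `superseded`. A refutation of C2 as typed (interface too weak) forces a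
re-typing of C2 over an explicit
L-factor-preservation hypothesis, not a pivot.

NOT DECOMPOSED YET. The explicit TAIL BOUND (constants) and the truncation protocol; the example σ
itself (field, lift, conductor) — C1 leaves them to the compute
seat and caps only the conductor; the local newvector/Whittaker bookkeeping at primes above 2 and √5
inside C2; the continuity/de Rham lemmas of
C3 (shared with QuarterDeficit1951's supply). The CALIBRATION is kept OUT of the cone by design and
is the first step of the kill protocol (route review 2026-08-17, objection A: C1 and C2 share every
hard-coded convention of `series`). Typed and elaborated this session (planner Sketch.lean, lean
check rc 0 against this module) as SolvableCalibration := for all golden data (F, a, ι₁, ι₂) and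
every σ : FramedArtinRep F 2 that is irreducible with finite SOLVABLE image, `ArtinRep.signature σ
ι₁ = (1,1)` and `(ArtinRep.signature σ ι₂).1 ≠ 1`, the conclusion `HybridAut F a ι₁ ι₂ σ` of C2
holds — literally C2's lets with `IsSolvable σ.toMonoidHom.range` in place of `¬ IsSolvable …` and
no `Corresponds`/avatar hypotheses. A theorem in substance (Langlands–Tunnell,
LanglandsBaseChange1980 / Tunnell1981: solvable image ⇒ σ ↔ cuspidal π(σ) with matching L- and
ε-factors at every place, any signature; dihedral Ind ψ = Hecke–Maass hybrid theta series) + the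
classical Hilbert–Maass newform dictionary; its dihedral instances are what CHEAPEST FALSIFIER (a)
computes. The gate has no `aside` item kind yet (add_items kind aside → KeyError 'aside',
2026-08-17T10:1xZ), so it is recorded here, not filed; file it `aside` when the kind lands.
Unit-sign consistency of the ideal-determined coefficients (checked on paper this session): det σ^∨
has signature (sgn, 1) and conductor dividing 𝔣(σ), hence every unit ε ≡ 1 mod 𝔣(σ) has ι₁(ε) > 0
and −I ∉ Γ₁(𝔣(σ)), so diag(ε, ε⁻¹)-automorphy imposes c(ε²ξ) = sgn(ι₁ε)·c(ξ) = c(ξ) — compatible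
with `coeff`.

CHEAPEST FALSIFIER. (a) Of the conventions (run first, hours): the dihedral calibration (a dihedral
instance of SolvableCalibration, NOT DECOMPOSED YET above) — build Ind_K^F ψ for K/F a totally real
quadratic extension and ψ a
ray-class character odd at exactly the places above ι₁, evaluate the same hybrid series and the same
defect; it must vanish to working precision.
(b) Of the bet: the smallest half-real A₅ quintic over ℤ[ω] (box search, minutes), its Crespo lift
and 50 Frobenius classes (a day), then one Arb
evaluation (core-hours): a defect ≤ 10⁻²⁰ kills C1 for that σ. (c) Lookup run this session:
zbMATH/galaxy searches for hybrid Maass–holomorphic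
Artin forms and mixed-parity icosahedral computations returned nothing (Kelmer arXiv:1208.5955 is a
trace formula, no Artin census; Booker
2005 and BSV 2006 are over ℚ); the hub's hodge-parity-lock card records "no engine" for this sector.

NUMBERS. F = ℚ(√5): discriminant 5, 𝔡 = (√5), class number = narrow class number = 1, ω = (1+√5)/2
of norm −1 (so multiplication by ω flips the sign at
ι₂ and implements the Maass sign ε₂). Conductor cap 10¹⁰ (norm). Heights: a Γ₁(𝔣)-element with
lower-left entry γ forces Im ≈ 1/|ι(γ)|, so the
truncation needs lattice points ξ with |ι_j ξ| ≲ (digits·ln 10 / 2π)·|ι_j γ|: ≈ 10⁷–10⁹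
K₀-evaluations for N(𝔣) ≈ 10⁶–10⁸ at 20 digits —
core-hours on the kit pool. Artin coefficients |a_σ(𝔪)| ≤ d(𝔪) (dimension 2, unitary eigenvalues)
give the tail bound.

DEFINITION REQUESTS. None blocking: K₀ is typed as the integral ∫₀^∞ e^(−x cosh t) dt, the per-ideal
Artin coefficients through `ArtinRep.eulerFactorAt` and
`Associates.count`, the hybrid series as a `tsum` over F (zero off the dual lattice). A Literature
home for "hybrid Hilbert–Maass Fourier
expansions" (Selberg/Kelmer) would shorten the items; to be requested only if a second route needs
it.

Novelty: Searches (2026-08-17): zbMATH ×14 (Caraiani–Newton / AKT modularity over CM fields; DGP 2010; GPY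
paramodular; Golyshev–van Straten;
Dummigan–Tornaría 2024 residual paramodularity; Ito–Koshikawa–Mieda 2018 vGT GL₃; Gunnells–Yasaki
−23; Jones 2016 ℚ(ζ₁₂); Booker 2005
"Numerical tests of modularity"; quinary/paramodular databases), `lit galaxy search` ×5
(paramodular; PSL(2,7); "Maass forms on GL(3)";
"Numerical tests of modularity"; level-61), `lit read` of arXiv:2301.10509, 1910.12986, 1609.04146,
2412.14289, 1811.11544, 1201.4132, 1505.01812
and Goldfeld's GL(n,ℝ) book §6; the hub's 60 open routes, 3 negatives, 12 barrier files, 29 open +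
60 closed idea cards (bottom-eigenvalue-census,
hodge-parity-lock-hybrid-vacuity, hessian-first-blood-certificate, booker-bootstrap-gl3,
edge-counting-shadows read in full); `lean search` of the
Artin / Galois APIs. OpenAlex/S2 rate-limited all session (recorded).
Nearest prior art found: zbl:1122.11032 (Booker 2005: non-rigorous numerical modularity tests of
explicit Dirichlet series for GL₂/ℚ, incl. even
icosahedral); doi:10.1155/IMRN/2006/71281 (BSV: certified Maass cusp forms on SL₂(ℤ) from numerical
candidates); arXiv:1208.5955 (Kelmer: hybrid
trace formula for Selberg's hybrid forms); on the hub: route-Langlands-QuarterDeficit1951 (certified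
trace-formula census, even icosahedral over ℚ)
and the variant-graded card bottom-eigenvalue-census.
Delta: the candidate is SUPPLIED by Galois theory (no spectral solve, no trace formula, no L-va  [refs: 10.1155/IMRN/2006/71281, 2301.10509, 1208.5955, doi:10.1155/IMRN/2006/71281]

Barriers (technique_class: certified-computation automorphy-defect hybrid-maass): - technique_class: certified-computation automorphy-defect hybrid-maass
- Literature.Barriers.Langlands.NonRegularWeightBarrier: evaded — nothing cohomological or
p-adically interpolated is used; the weight-one ⊗ Maass-1/4 form is handled through its explicit
archimedean Whittaker functions (e^(2πiξz), √y K₀), which the barrier's technique class never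
touches.
- Literature.Barriers.Langlands.SolvableImageBarrier: not engaged — no base change/descent is
performed; the insoluble (icosahedral) image is exactly why the instance is open, and the solvable
(dihedral) case enters only as the CALIBRATION theorem.
- Literature.Barriers.Langlands.ShimuraVarietyRealizationBarrier: not engaged — F is totally real,
but no Galois representation is constructed and no variety is used; the Galois side is an Artin
representation given by a number field.
- Literature.Barriers.Langlands.TaylorWilesNumericalCoincidence, PatchingLocalComponentBarrier,
ResiduallyReducibleBarrier, ModPLanglandsGL2BeyondQp, PaskunasCentreFinitenessFails,
MonodromyNotClosedUnderPadicLimits, TwistedEndoscopySelfDual, ShtukaConstantFieldBarrier,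
FamilyWitnessConsecutiveWeights: not engaged (no lifting, no local p-adic correspondence, no
endoscopy, no families).
- Uncatalogued, load-bearing: the typed summit is Hodge–Tate-blind (no archimedean clause in
`Corresponds`), which defeats census refutations wherever competitor ∞-types carry no Galois
representations; here the Γ-factor pole-set lemma (automorphic FE vs Artin FE

History (route lifecycle, newest last):
- 2026-08-17T10:10:20Z · rev 5: dropped SolvableCalibration — rbadge g2: undo my add of stmt-Langlands-18005 SolvableCalibration — the gate ACCEPTED kind `aside` into the ledger (rev entry 10:08:56Z) but its renderer has n (planner-rbadge-Langlands-HybridParityDefect-f9b893cf-g2-0)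
- 2026-08-17T12:51:33Z · rev 10: restated Assembly (stmt-Langlands-17969) — rbadge g7 route-repair (needs_repair `route.declared-not-in-cone: Assembly`, bc6 stamp ts 08:41:51Z = birth; the audit cone has been in_cone 4/4 / unused [] sin (planner-rbadge-Langlands-HybridParityDefect-f9b893cf-g7-0)
- 2026-08-24T04:21:56Z · DORMANT — reconciler: no traction for 6.5 d (last activity item-evidence-added at 2026-08-17T15:02:46Z); parked, not closed — `ledger route dormant route-Langlands-Hybrid (operator:999:927045)
- 2026-08-31T20:59:55Z · REACTIVATED (open) — reconciler: reactivated — activity route-repaired at 2026-08-31T20:03:41Z after parking at 2026-08-24T04:21:56Z (operator:999:4175316)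

sub-problem: Langlands · status: open · opened planner-plan-novel-Langlands-Langlands-e266a39d-d-v2-g15-0 2026-08-17T08:35:06Z · rev 12 · ledger route-Langlands-HybridParityDefect
GENERATED by the gate from the ledger (D-0016/17). Provers cite these decls: `theorem foo : Summit.Langlands.Langlands.Theses.HybridParityDefect.<Decl> := …` in Summits/Langlands/Langlands/Theorems/<Name>.lean.
-/

namespace Summit.Langlands.Langlands.Theses.HybridParityDefect

open scoped BigOperators Topology Manifold Classical MeasureTheory ProbabilityTheory Matrix InnerProductSpace ComplexConjugate ContinuousMap
open Filter Set Function TopologicalSpace MeasureTheory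

attribute [summit_statement] _root_.Langlands

/-- item stmt-Langlands-17966 · crux · rank 2 · open · by planner
why it might fail: Langlands true ⇒ (B) over ℚ(√5) gives the hybrid newform, f_σ is automorphic and every certified defect ≤ tail; no mixed-parity icosahedral σ of conductor norm ≤ 10¹⁰ may exist (C1 vacuous); the Lean artefact ¬HybridAut needs in-kernel ball arithmetic for K₀/exp tsums (none in Mathlib).
sources: zbl:1122.11032, doi:10.1155/IMRN/2006/71281, arXiv:1208.5955, doi:10.1016/0021-8693(89)90263-6, arXiv:1009.5388, arXiv:1611.02831
[crux] [computational bet] over the golden field F = ℚ(√5) (typed: finrank 2, a² = 5, embeddings ι₁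
≠ ι₂) there is σ : Γ_F → GL₂(ℂ) irreducible with finite insoluble image, signature (1,1) at ι₁ and
(2,0) or (0,2) at ι₂, Artin conductor norm ≤ 10¹⁰, such that the explicit hybrid series f_σ (Artin
Dirichlet coefficients of the ideals (ξ√5), ξ ∈ 𝔡⁻¹ with ι₁ξ > 0; Maass sign ε₂ on ι₂ξ < 0; e(ι₁ξ
z₁)·√y₂K₀(2π|ι₂ξ|y₂)·e(ι₂ξ x₂)) violates weight-(1,0) automorphy f(γz) = (ι₁(γ)z₁+ι₁(δ)) f(z) for
some (α β; γ δ) ∈ SL₂(𝓞) with γ ∈ 𝔣(σ), α ≡ δ ≡ 1 mod 𝔣(σ), at some point of ℍ × ℍ. Pipeline for ONE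
kit job chain: box-search quintics over ℤ[ω] with square discriminant, A₅ group over F and real-root
counts (5 | 1) at (ι₂ | ι₁) (half-real icosahedral field, not base change); Crespo lift to 2.A₅ and
minimal-conductor twist; Frobenius classes in 2.A₅ (Dokchitsers' algorithm) ⇒ a_σ(𝔭), ramified Euler
factors ⇒ all a_σ(𝔪); Arb evaluation of the two truncations at heights ~N(𝔣)^(-1/2) with the
explicit tail bound; TRUE-certificate (defect ≥ η > tails) ⇒ with C2, C3: ¬Langlands;
FALSE-certificate (defect ≤ 10⁻²⁰·|f| at ≥ 10 generic (γ,z) for the smallest examples) ⇒ route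
closes refuted:HybridDefectWi -/
@[route_item "route-Langlands-HybridParityDefect", crux]
def HybridDefectWitness : Prop :=
  let artinCoeff : (F : Type) → [Field F] → [NumberField F] → Literature.NumberTheory.GaloisRepresentations.ArtinRep F (Fin 2 → ℂ) → Ideal (NumberField.RingOfIntegers F) → ℂ := fun F _ _ σ I => (by classical exact ∏ᶠ v : IsDedekindDomain.HeightOneSpectrum (NumberField.RingOfIntegers F), PowerSeries.coeff ((Associates.mk v.asIdeal).count (Associates.mk I).factors) ((Literature.NumberTheory.GaloisRepresentations.ArtinRep.eulerFactorAt σ v : PowerSeries ℂ)⁻¹)); let coeff : (F : Type) → [Field F] → [NumberField F] → F → (F →+* ℝ) → (F →+* ℝ) → Literature.NumberTheory.GaloisRepresentations.FramedArtinRep F 2 → F → ℂ := fun F _ _ a ι₁ ι₂ σ ξ => @dite ℂ ((∃ m : NumberField.RingOfIntegers F, (m : F) = ξ * a) ∧ 0 < ι₁ ξ) (Classical.dec _) (fun h => artinCoeff F σ.toArtinRep (Ideal.span {h.1.choose}) * (if ι₂ ξ < 0 ∧ (Literature.NumberTheory.GaloisRepresentations.ArtinRep.signature σ.toArtinRep ι₂).1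 ≠ 2 then -1 else 1)) (fun _ => 0); let series : (F : Type) → [Field F] → [NumberField F] → F → (F →+* ℝ) → (F →+* ℝ) → Literature.NumberTheory.GaloisRepresentations.FramedArtinRep F 2 → ℂ → ℂ → ℂ := fun F _ _ a ι₁ ι₂ σ z₁ z₂ => ∑' ξ : F, coeff F a ι₁ ι₂ σ ξ * Complex.exp (2 * Real.pi * Complex.I * (ι₁ ξ : ℂ) * z₁) * (((Real.sqrt z₂.im : ℝ) : ℂ) * ((∫ t in Set.Ioi (0 : ℝ), Real.exp (-(2 * Real.pi * |ι₂ ξ| * z₂.im * Real.cosh t)) : ℝ) : ℂ)) * Complex.exp (2 * Real.pi * Complex.I * (ι₂ ξ : ℂ) * (z₂.re : ℂ)); let act : (F : Type) → [Field F] → (F →+* ℝ) → F → F → F → F → ℂ → ℂ := fun F _ ι α β γ δ z => ((ι α : ℂ) * z + (ι β : ℂ)) / ((ι γ : ℂ) * z + (ι δ : ℂ)); let HybridAut : (F : Type) → [Field F] → [NumberField F] → F → (F →+* ℝ) → (F →+* ℝ) → Literature.NumberTheory.GaloisRepresentations.FramedArtinRep F 2 → Prop := fun F _ _ a ι₁ ι₂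 σ => ∀ α β γ δ : NumberField.RingOfIntegers F, α * δ - β * γ = 1 → γ ∈ σ.toGaloisRep.artinConductor → α - 1 ∈ σ.toGaloisRep.artinConductor → δ - 1 ∈ σ.toGaloisRep.artinConductor → ∀ z₁ z₂ : ℂ, 0 < z₁.im → 0 < z₂.im → series F a ι₁ ι₂ σ (act F ι₁ α β γ δ z₁) (act F ι₂ α β γ δ z₂) = ((ι₁ (γ : F) : ℂ) * z₁ + (ι₁ (δ : F) : ℂ)) * series F a ι₁ ι₂ σ z₁ z₂; let MixedIco : (F : Type) → [Field F] → [NumberField F] → (F →+* ℝ) → (F →+* ℝ) → Literature.NumberTheory.GaloisRepresentations.FramedArtinRep F 2 → Prop := fun F _ _ ι₁ ι₂ σ => σ.toGaloisRep.IsIrreducible ∧ (Set.range σ).Finite ∧ ¬ IsSolvable σ.toMonoidHom.range ∧ Literature.NumberTheory.GaloisRepresentations.ArtinRep.signature σ.toArtinRep ι₁ = (1, 1) ∧ (Literature.NumberTheory.GaloisRepresentations.ArtinRep.signature σ.toArtinRep ι₂).1 ≠ 1; let Golden : (F : Type) → [Field F] → [NumberField F] → F → (F →+* ℝ) → (F →+*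 ℝ) → Prop := fun F _ _ a ι₁ ι₂ => Module.finrank ℚ F = 2 ∧ a ^ 2 = 5 ∧ ι₁ ≠ ι₂ ∧ 0 < ι₁ a; ∃ (F : Type) (_ : Field F) (_ : NumberField F) (a : F) (ι₁ ι₂ : F →+* ℝ), Golden F a ι₁ ι₂ ∧ ∃ σ : Literature.NumberTheory.GaloisRepresentations.FramedArtinRep F 2, MixedIco F ι₁ ι₂ σ ∧ σ.toGaloisRep.artinConductorNat ≤ 10 ^ 10 ∧ ¬ HybridAut F a ι₁ ι₂ σ

/-- item stmt-Langlands-17967 · crux · rank 3 · open · by planner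
why it might fail: as TYPED: `IsLocalLanglandsGL` may not expose L- /ε-factor preservation strongly enough to read ramified coefficients and 𝔣(σ) off `Corresponds`; a convention slip (sign rule, 𝔡⁻¹, automorphy factor, dual) would falsify the identity — the solvable calibration catches it.
sources: Casselman1973, BuzzardGeeLMS2014, HarrisTaylorAMS2001, TateCorvallis1979, MartinetDurham1977, doi:10.1215/S0012-7094-78-04529-5
[crux] [typed reciprocity ⇒ the explicit series is the newform] for F, a, ι₁, ι₂ golden data, σ
mixed-parity icosahedral, ρ an ℓ-adic framed representation with ι(ᵗρ⁻¹) = σ (avatar of σ^∨ — the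
Frobenius bookkeeping of `Corresponds`: arithmetic Frobenius of ρ has eigenvalues α_j⁻¹, the newform
coefficient is Σα_j, the tree's Artin Euler factors use arithmetic Frobenius), every cuspidal
L-algebraic π of GL₂(𝔸_F) with `Corresponds 𝓡 ι π ρ` makes f_σ weight-(1,0) automorphic under
Γ₁(𝔣(σ)) ∩ SL₂(𝓞). Chain: LGC at all finite v ⇒ conductor(π) = 𝔣(σ), L_v(s,π) = L_v(s,σ) (rec
preserves L- and ε-factors), central character det σ^∨; automorphic FE of Λ(s,π) (JL) and Artin FE
of Λ(s,σ) (Brauer) with equal finite parts ⇒ γ_π/γ_σ = c·(γ_π/γ_σ)(1−s)⁻¹-type identity ⇒ equal pole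
multisets ⇒ π_ι₁ = PS(1,sgn) (weight-one limit DS), π_ι₂ = PS(sgnᵃ,sgnᵃ) with (−1)ᵃ = σ(c₂) — no
Hodge–Tate input; Casselman newvector is K₁(𝔣)-fixed; class number and narrow class number one ⇒ one
classical component; Fourier expansion over 𝔡⁻¹ = (1/√5)𝓞 with the weight-one (e^{2πiξ₁z₁}, ξ₁ > 0)
and weight-zero parameter-0 (√y K₀, sign ε₂ under ξ ↦ ωξ from diag(ω,1) ∈ K₀) Whittaker functions;
coefficients = Hecke eigen -/
@[route_item "route-Langlands-HybridParityDefect", crux]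
def HybridDictionary : Prop :=
  let artinCoeff : (F : Type) → [Field F] → [NumberField F] → Literature.NumberTheory.GaloisRepresentations.ArtinRep F (Fin 2 → ℂ) → Ideal (NumberField.RingOfIntegers F) → ℂ := fun F _ _ σ I => (by classical exact ∏ᶠ v : IsDedekindDomain.HeightOneSpectrum (NumberField.RingOfIntegers F), PowerSeries.coeff ((Associates.mk v.asIdeal).count (Associates.mk I).factors) ((Literature.NumberTheory.GaloisRepresentations.ArtinRep.eulerFactorAt σ v : PowerSeries ℂ)⁻¹)); let coeff : (F : Type) → [Field F] → [NumberField F] → F → (F →+* ℝ) → (F →+* ℝ) → Literature.NumberTheory.GaloisRepresentations.FramedArtinRep F 2 → F → ℂ := fun F _ _ a ι₁ ι₂ σ ξ => @dite ℂ ((∃ m : NumberField.RingOfIntegers F, (m : F) = ξ * a) ∧ 0 < ι₁ ξ) (Classical.dec _) (fun h => artinCoeff F σ.toArtinRep (Ideal.span {h.1.choose}) * (if ι₂ ξ < 0 ∧ (Literature.NumberTheory.GaloisRepresentations.ArtinRep.signature σ.toArtinRep ι₂).1 ≠ 2 then -1 else 1)) (fun _ => 0); let series : (F : Type) → [Field F]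 → [NumberField F] → F → (F →+* ℝ) → (F →+* ℝ) → Literature.NumberTheory.GaloisRepresentations.FramedArtinRep F 2 → ℂ → ℂ → ℂ := fun F _ _ a ι₁ ι₂ σ z₁ z₂ => ∑' ξ : F, coeff F a ι₁ ι₂ σ ξ * Complex.exp (2 * Real.pi * Complex.I * (ι₁ ξ : ℂ) * z₁) * (((Real.sqrt z₂.im : ℝ) : ℂ) * ((∫ t in Set.Ioi (0 : ℝ), Real.exp (-(2 * Real.pi * |ι₂ ξ| * z₂.im * Real.cosh t)) : ℝ) : ℂ)) * Complex.exp (2 * Real.pi * Complex.I * (ι₂ ξ : ℂ) * (z₂.re : ℂ)); let act : (F : Type) → [Field F] → (F →+* ℝ) → F → F → F → F → ℂ → ℂ := fun F _ ι α β γ δ z => ((ι α : ℂ) * z + (ι β : ℂ)) / ((ι γ : ℂ) * z + (ι δ : ℂ)); let HybridAut : (F : Type) → [Field F] → [NumberField F] → F → (F →+* ℝ) → (F →+* ℝ) → Literature.NumberTheory.GaloisRepresentations.FramedArtinRep F 2 → Prop := fun F _ _ a ι₁ ι₂ σ => ∀ α β γ δ : NumberField.RingOfIntegers F, α * δ - β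 * γ = 1 → γ ∈ σ.toGaloisRep.artinConductor → α - 1 ∈ σ.toGaloisRep.artinConductor → δ - 1 ∈ σ.toGaloisRep.artinConductor → ∀ z₁ z₂ : ℂ, 0 < z₁.im → 0 < z₂.im → series F a ι₁ ι₂ σ (act F ι₁ α β γ δ z₁) (act F ι₂ α β γ δ z₂) = ((ι₁ (γ : F) : ℂ) * z₁ + (ι₁ (δ : F) : ℂ)) * series F a ι₁ ι₂ σ z₁ z₂; let MixedIco : (F : Type) → [Field F] → [NumberField F] → (F →+* ℝ) → (F →+* ℝ) → Literature.NumberTheory.GaloisRepresentations.FramedArtinRep F 2 → Prop := fun F _ _ ι₁ ι₂ σ => σ.toGaloisRep.IsIrreducible ∧ (Set.range σ).Finite ∧ ¬ IsSolvable σ.toMonoidHom.range ∧ Literature.NumberTheory.GaloisRepresentations.ArtinRep.signature σ.toArtinRep ι₁ = (1, 1) ∧ (Literature.NumberTheory.GaloisRepresentations.ArtinRep.signature σ.toArtinRep ι₂).1 ≠ 1; let DualAvatar : (F : Type) → [Field F] → [NumberField F] → (ℓ : ℕ) → [Fact ℓ.Prime] → (PadicAlgCl ℓ ≃+* ℂ)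 → Literature.NumberTheory.GaloisRepresentations.FramedArtinRep F 2 → Literature.NumberTheory.GaloisRepresentations.FramedGaloisRep F (PadicAlgCl ℓ) 2 → Prop := fun F _ _ ℓ _ ι σ ρ => ∀ g, (((ρ g)⁻¹ : GL (Fin 2) (PadicAlgCl ℓ)) : Matrix (Fin 2) (Fin 2) (PadicAlgCl ℓ)).transpose.map ι = ((σ g : GL (Fin 2) ℂ) : Matrix (Fin 2) (Fin 2) ℂ); let Golden : (F : Type) → [Field F] → [NumberField F] → F → (F →+* ℝ) → (F →+* ℝ) → Prop := fun F _ _ a ι₁ ι₂ => Module.finrank ℚ F = 2 ∧ a ^ 2 = 5 ∧ ι₁ ≠ ι₂ ∧ 0 < ι₁ a; ∀ (F : Type) [Field F] [NumberField F] (a : F) (ι₁ ι₂ : F →+* ℝ), Golden F a ι₁ ι₂ → ∀ σ : Literature.NumberTheory.GaloisRepresentations.FramedArtinRep F 2, MixedIco F ι₁ ι₂ σ → ∀ (RD : Summit.Langlands.ReciprocityData F) (ℓ : ℕ) [Fact ℓ.Prime] (ι : PadicAlgCl ℓ ≃+* ℂ) (ρ : Literature.NumberTheory.GaloisRepresentations.FramedGaloisRep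 F (PadicAlgCl ℓ) 2), DualAvatar F ℓ ι σ ρ → ∀ (hcpt : Literature.NumberTheory.Automorphic.isCompact_glFiniteIntegralLevel 2 F) (π : Literature.NumberTheory.Automorphic.CuspidalAutomorphicRepData 2 F hcpt), π.1.IsLAlgebraic → Summit.Langlands.Corresponds RD ι π.1 ρ → HybridAut F a ι₁ ι₂ σ

/-- item stmt-Langlands-17968 · support · rank 4 · closed · proved by Summit.Langlands.Langlands.Theorems.HybridParityDefectArtinAvatarSupply.artinAvatarSupply (prover) · by planner
why it might fail: as TYPED: continuity of ι⁻¹∘σ^∨ into GL₂(ℚ̄_ℓ) and `IsDeRhamFramed` for the pinned datum must follow from finite image + unramified-at-ℓ with the tree's `PstWeilDeligneData` interface; if weaker than for the 1951 supply the item stalls (not false).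
sources: BuzzardGeeLMS2014, FontaineMazurGeometric1995, DeligneSerreASENS1974, DoudMoore2006
[crux] [supply, known in substance] every mixed-parity icosahedral σ : Γ_F → GL₂(ℂ) has, for every
reciprocity datum 𝓡 of F, some prime ℓ, some field isomorphism ι : ℚ̄_ℓ ≃ ℂ and a framed ℓ-adic ρ
with ι(ᵗρ⁻¹) = σ (avatar of the contragredient) that is irreducible and geometric in the summit's
sense (`IsGeometricFramed 𝓡 ρ`: a.e. unramified; de Rham at v ∣ ℓ for the PINNED Fontaine datum —
choose ℓ above which σ is unramified, the case the structure axioms of `PstWeilDeligneData` cover,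
exactly as in the landed QuarterDeficit1951IcosahedralSupplyAway). Witness: ρ := ι⁻¹ ∘ σ^∨,
continuous because the kernel is open (finite image), irreducible because σ is. [difficulty: M] -/
@[route_item "route-Langlands-HybridParityDefect", crux]
def ArtinAvatarSupply : Prop :=
  let MixedIco : (F : Type) → [Field F] → [NumberField F] → (F →+* ℝ) → (F →+* ℝ) → Literature.NumberTheory.GaloisRepresentations.FramedArtinRep F 2 → Prop := fun F _ _ ι₁ ι₂ σ => σ.toGaloisRep.IsIrreducible ∧ (Set.range σ).Finite ∧ ¬ IsSolvable σ.toMonoidHom.range ∧ Literature.NumberTheory.GaloisRepresentations.ArtinRep.signature σ.toArtinRep ι₁ = (1, 1) ∧ (Literature.NumberTheory.GaloisRepresentations.ArtinRep.signature σ.toArtinRep ι₂).1 ≠ 1; let DualAvatar : (F : Type) → [Field F] → [NumberField F] → (ℓ : ℕ) → [Fact ℓ.Prime] → (PadicAlgCl ℓ ≃+* ℂ) → Literature.NumberTheory.GaloisRepresentations.FramedArtinRep F 2 → Literature.NumberTheory.GaloisRepresentations.FramedGaloisRep F (PadicAlgCl ℓ) 2 → Prop := fun F _ _ ℓ _ ι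 σ ρ => ∀ g, (((ρ g)⁻¹ : GL (Fin 2) (PadicAlgCl ℓ)) : Matrix (Fin 2) (Fin 2) (PadicAlgCl ℓ)).transpose.map ι = ((σ g : GL (Fin 2) ℂ) : Matrix (Fin 2) (Fin 2) ℂ); ∀ (F : Type) [Field F] [NumberField F] (ι₁ ι₂ : F →+* ℝ) (σ : Literature.NumberTheory.GaloisRepresentations.FramedArtinRep F 2), MixedIco F ι₁ ι₂ σ → ∀ RD : Summit.Langlands.ReciprocityData F, ∃ (ℓ : ℕ) (_ : Fact ℓ.Prime) (ι : PadicAlgCl ℓ ≃+* ℂ) (ρ : Literature.NumberTheory.GaloisRepresentations.FramedGaloisRep F (PadicAlgCl ℓ) 2), DualAvatar F ℓ ι σ ρ ∧ ρ.toGaloisRep.IsIrreducible ∧ Summit.Langlands.IsGeometricFramed RD ρ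

-- `ArtinAvatarSupply` holds: proved by `Summit.Langlands.Langlands.Theorems.HybridParityDefectArtinAvatarSupply.artinAvatarSupply` (its module imports this route file, so no `_holds` link can be stated here).

-- earlier Assembly (stmt-Langlands-17969, replaced 2026-08-17T12:51:33Z -> stmt-Langlands-18119): retired by None — HybridDefectWitness → HybridDictionary → ArtinAvatarSupply → ¬ _root_.Langlands
/-- item stmt-Langlands-18119 · assembly · rank 1 · open · by planner
sources: BuzzardGeeLMS2014, HarrisTaylorAMS2001
[assembly] frame #1 of the thesis: X → ¬Langlands with X := HybridDefectWitness ∧ HybridDictionary ∧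
ArtinAvatarSupply (the thesis' `Lean:` line; refutation shape). Proved in-kernel inside the deciding
theorem `closes` (block `cert`, pure logic: assume Langlands; C1 gives the golden data, σ and
¬HybridAut; Langlands F gives 𝓡 and conjunct (B) at n = 2; C3 gives the geometric ℓ-adic avatar ρ of
σ^∨; (B) gives a cuspidal L-algebraic π with Corresponds 𝓡 ι π ρ; C2 gives HybridAut —
contradiction); a prover may land it verbatim as `theorem … : Assembly`. [difficulty: provable-now] -/
@[route_item "route-Langlands-HybridParityDefect"]
def Assembly : Prop :=
  (HybridDefectWitness ∧ HybridDictionary ∧ ArtinAvatarSupply) → ¬ _root_.Langlands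

/-! D-0027 §2.1 — DECIDING THEOREM (planner-authored via `route open/edit --closes-file`; by planner-rbadge-Langlands-HybridParityDefect-f9b893cf-g7-0 2026-08-17T12:51:33Z):
its hypotheses are this route's items and its conclusion the sub-problem Statement (glue_lint), and it elaborates with this file. -/

@[closes "route-Langlands-HybridParityDefect"] theorem closes (h₁ : HybridDefectWitness) (h₂ : HybridDictionary) (h₃ : ArtinAvatarSupply) :
    ¬ _root_.Langlands := by
  -- Deciding theorem, refutation shape (D-0027 §2.1; crux-only rule 2026-08-16): the binders are
  -- exactly the route's three mathematical items — cruxes C1 `HybridDefectWitness`,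
  -- C2 `HybridDictionary` and the support C3 `ArtinAvatarSupply` — and the conclusion is
  -- `¬ Langlands`.  The frame item `Assembly` (= thesis X → ¬Langlands with
  -- X := HybridDefectWitness ∧ HybridDictionary ∧ ArtinAvatarSupply, the `Lean:` line of the thesis)
  -- is PROVED here in-kernel (`cert`, sorry-free) and then applied to ⟨h₁, h₂, h₃⟩, so it lies in
  -- the cone of `closes` as a derived item and is never an assumed hypothesis.  Argument: assume
  -- `Langlands`; C1 gives the golden-field data (F, a, ι₁, ι₂), the mixed-parity icosahedral σ and
  -- the failure of hybrid automorphy; `Langlands F` gives a reciprocity datum 𝓡 and conjunct (B)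
  -- at n = 2 (compact-open level from `isCompact_glFiniteIntegralLevel_holds 2 F`); C3 supplies an
  -- irreducible geometric ℓ-adic avatar ρ of σ^∨; (B) yields a cuspidal L-algebraic π with
  -- `Corresponds 𝓡 ι π ρ`; C2 turns that into hybrid automorphy of f_σ — contradiction.
  have cert : Assembly := by
    rintro ⟨h₁', h₂', h₃'⟩ hL
    obtain ⟨F, _, _, a, ι₁, ι₂, hgold, σ, hσ, -, hnot⟩ := h₁'
    obtain ⟨⟨RD⟩, hall⟩ := hL F
    obtain ⟨ℓ, _, ι, ρ, hav, hirr, hgeo⟩ := h₃' F ι₁ ι₂ σ hσ RD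
    have hB := (hall RD 2 (by norm_num)
      (Literature.NumberTheory.Automorphic.isCompact_glFiniteIntegralLevel_holds 2 F)).2
    obtain ⟨π, hLalg, hcorr⟩ := hB ℓ ι ρ hirr hgeo
    exact hnot (h₂' F a ι₁ ι₂ hgold σ hσ RD ℓ ι ρ hav _ π hLalg hcorr)
  exact cert ⟨h₁, h₂, h₃⟩

end Summit.Langlands.Langlands.Theses.HybridParityDefect
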